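import Summits.BirchSwinnertonDyer.BirchSwinnertonDyer.Theorems.ByReductionTypeAtTwoSupersingularSharpTwo
import Summits.BirchSwinnertonDyer.Rank1Residual.Supersingular.BlindPointFlatTwo
import Summits.BirchSwinnertonDyer.Rank1Residual.Supersingular.SprungPollackConsistency
import Literature.NumberTheory.EllipticCurves.BSDRootNumberOddParityProofs
import HarnessLib

/-!
# Route `ByReductionTypeAtTwo` (rung K4), crux `SupersingularRankZeroAtTwo` (item
# stmt-BirchSwinnertonDyer-19097), line `signed_halves_two` v3: the HARDEST stub read at the ORDER-2
# CHARACTER of `Γ` — a falsifiable PREDICTION at `p = 2`: `ξ⁺(−2) = 0` whenever `w_E · χ₈(N_E) = +1`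
# (seat `bsd-2adic-ss-1`, GEN 5)

HONEST FRAMING (cell `bsd-2adic`, run/shared/lean/pub/bsd-2adic/, HUMAN RULINGS D-0036/D-0059/D-0074):
THEOREMS ONLY; every research input an explicit hypothesis (here: the registered stub
`stub_zeroKobayashiLower` = the tree's typed `KobayashiLowerDivisibility W 2 1`, per curve); no
definition, no named fact, no `sorry`; nothing booked; BSD is not proved by any of this. PARTITION
(D-0054): X5@2 good-ss (B1·O1; 757 r0 book230 classes; the `a₂ = 0` sub-row = 208) × p = 2 —
types-the-object-of; closes none. bears_on: K4 (route-BirchSwinnertonDyer-ByReductionTypeAtTwo item 19097).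

## What is proved

`p = 2` has a feature absent at odd `p`: the Iwasawa algebra `Λ = ℤ₂⟦T⟧` of the cyclotomic
`ℤ₂`-extension has TWO `ℤ₂`-points where `1 + T = ±1` — the trivial character `T = 0` and the
character of ORDER 2, `T = −2` (the layer `ℚ₁ = ℚ(√2)`, Dirichlet character `χ₈`; Greenberg, LNM 1716
p. 181). The tree already knows the analytic side there (cell `b2b-bsdres`, O1 lens-1, files
`Supersingular/BlindPoint*`): for the newform `f` of `E` with good supersingular reduction at `2` and
EVERY Sprung pair `(L♯, L♭)` at `2`,
`(9 − a₂²)·L♭(−2) + a₂·L♯(−2) = 0` when `w_E·χ₈(N_E) = +1` (`BlindFlat.flatLaw_evalAt_neg_two_of_rootNumber`),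
so at `a₂ = 0`: **`L♭(−2) = 0`** — a FORCED zero of the even-sign `2`-adic `L`-function at the
order-2 character, although `L(E ⊗ χ₈, 1) ≠ 0` generically there (`w(E ⊗ χ₈) = w_E χ₈(N_E) = +1`).

This file transports that zero through the line's hardest stub:

* `C_den_mul_eq_C_num_mul_of_iwasawaToPowerSeries_eq` — bookkeeping: `ι g = ϖ · ι M` in `ℚ₂⟦T⟧`
  (`ϖ ∈ ℚ`) is the INTEGRAL identity `den(ϖ)·g = num(ϖ)·M` in `Λ` (`ι` injective).
* `evalAt_neg_two_charGenerator_eq_zero_of_kobayashiLowerDivisibility_two` — **THE PREDICTION, per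
  curve**: `E = W` good at `2`, `a₂ = 0`, `w_E·χ₈(N_E) = +1`, and `KobayashiLowerDivisibility W 2 1`
  (`char X⁺ = (g₀)`, `ι g₀ = ϖ·ι(L♭·h)` over every Pollack pair at `2`) ⇒ EVERY generator `g` of
  `char X⁺(E/ℚ_∞)` of EVERY dual datum has `g(−2) = 0` (`BlindLever.evalAt (−2) g = 0`), i.e.
  `(T + 2) ∣ char X⁺`: the even signed Selmer group `Sel⁺(E/ℚ_∞)` must have POSITIVE corank at the
  order-2 character. (At `2`, `a₂ = 0`, every Pollack pair is a Sprung pair with `a = 0`,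
  `isSprungPair_zero_iff`; generators of a principal ideal of the domain `Λ` are associates.)
* `evalAt_neg_two_charGenerator_eq_zero_of_kobayashiLowerDivisibility_two_of_rankZero` — on the
  crux's domain (analytic rank `0`, so `w_E = +1` unconditionally, `rootNumber_eq_one_of_even_analyticRank`)
  the sign condition is just `χ₈(N_E) = +1`, i.e. `N_E ≡ ±1 (mod 8)`.
* `zeroKobayashiLower_prediction_orderTwoChar` — CLASS LEVEL, hypothesis = the registered signature
  of `stub_zeroKobayashiLower` VERBATIM: on the `a₂ = 0` sub-row with `χ₈(N_E) = +1`, every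
  characteristic power series of `X⁺(E/ℚ_∞)` vanishes at `T = −2`.

## Why this is a TEST of the stub and not (yet) a refutation — the parity mechanism (memo grade)

At the order-2 character the even local condition of Kobayashi's `Sel⁺` is NOT the Kummer
condition of the twist `E^{(2)}`: `E⁺` lives on the trivial and the EVEN-level characters, so its
`χ₈`-component is a Lagrangian of `H¹(ℚ₂, V(E^{(2)}))` transverse to `H¹_f` — and comparing Selmer
parities for two Lagrangians that differ at one place flips the parity (Dokchitser–Dokchitser /
Mazur–Rubin): `dim Sel_{ℓ⁺}(E^{(2)}) ≡ 1 + ord_{s=1} L(E^{(2)}, s) (mod 2)`, odd exactly when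
`w(E^{(2)}) = w_E χ₈(N_E) = +1` — the same sign condition as the forced zero `L♭(−2) = 0`. The odd
sign is the mirror image: `E⁻(k₁) = E(k₁)` (no condition at the odd layer `1`), so at `χ₈` the minus
condition IS the Kummer one and `Sel⁻` is odd exactly when `w(E^{(2)}) = −1` — matching the tree's
`tsum_sharp_neg_two_eq_zero` (`L♯(−2) = 0` when `w_E χ₈(N_E) = −1`; `L♯` is the odd-sign function,
`kobayashiL (−1)`). So both of Sprung's forced zeros at `T = −2` are what a correct signed theory at
`2` predicts on the algebraic side; a DISPROVER who shows `X⁺/(T+2)X⁺` FINITE for one rank-`0`,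
`a₂ = 0`, `N ≡ ±1 (mod 8)` curve kills `stub_zeroKobayashiLower` (and the even main conjecture at `2`
in the Sprung normalisation); a proof that it is infinite is evidence for the line. Nothing of this
paragraph is asserted in the kernel.

References: S. Kobayashi, Invent. Math. 152 (2003) Def. 1.1, Conjecture p. 2 [Kobayashi2003];
F. Sprung, ANT 11 (2017) Thm. 1.12, Cor. 4.4 [Sprung2017]; B. Mazur, J. Tate, J. Teitelbaum, Invent.
Math. 84 (1986) §I.17 [MazurTateTeitelbaum1986Invent]; R. Greenberg, LNM 1716 (1999) p. 181
[GreenbergLNM1716]; R. Pollack, Duke 118 (2003) Prop. 6.18 [Pollack2003]; J. H. Silverman, AEC (2009)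
C.16 [SilvermanAEC2009].
-/

set_option autoImplicit false
-- the Theorems namespace of this sub repeats the summit name by design (D-0017 nested layout)
set_option linter.dupNamespace false

noncomputable section

open scoped Classical MatrixGroups ModularForm

open CongruenceSubgroup WeierstrassCurve Literature.NumberTheory.EllipticCurves
  Literature.NumberTheory.EllipticCurves.ModularForms Literature.NumberTheory.EllipticCurves.Sprung2017
  Literature.NumberTheory.EllipticCurves.Rank1Residual Literature.NumberTheory.EllipticCurves.Rank1Residual.Typed
  Literature.NumberTheory.EllipticCurves.Kobayashi2003 ZpExtension
  Summit.BirchSwinnertonDyer.Rank1Residual Summit.BirchSwinnertonDyer.Rank1Residual.Supersingular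
  Summit.BirchSwinnertonDyer.Rank1Residual.Supersingular.BlindLever

namespace Summit.BirchSwinnertonDyer.BirchSwinnertonDyer.Theorems

/-! ## §1 Bookkeeping: a rational period ratio in `ℚ₂⟦T⟧` is an integral identity in `Λ` -/

/-- **`ι g = ϖ · ι M` with `ϖ ∈ ℚ` ⇒ `den(ϖ) · g = num(ϖ) · M` in `Λ = ℤ₂⟦T⟧`** (`ι : Λ ↪ ℚ₂⟦T⟧` is
injective, `iwasawaToPowerSeries_injective`; `ϖ · den(ϖ) = num(ϖ)`). Bookkeeping. [folklore] -/
theorem C_den_mul_eq_C_num_mul_of_iwasawaToPowerSeries_eq {ϖ : ℚ} {g M : IwasawaAlgebra 2}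
    (h : iwasawaToPowerSeries 2 g = PowerSeries.C (ϖ : ℚ_[2]) * iwasawaToPowerSeries 2 M) :
    PowerSeries.C ((ϖ.den : ℤ) : ℤ_[2]) * g = PowerSeries.C ((ϖ.num : ℤ) : ℤ_[2]) * M := by
  apply iwasawaToPowerSeries_injective 2
  have hden : ((ϖ.den : ℤ) : ℚ) * ϖ = (ϖ.num : ℚ) := by
    have := Rat.mul_den_eq_num ϖ
    push_cast
    linarith [this]
  have key : (algebraMap ℤ_[2] ℚ_[2]) ((ϖ.den : ℤ) : ℤ_[2]) * (ϖ : ℚ_[2]) =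
      (algebraMap ℤ_[2] ℚ_[2]) ((ϖ.num : ℤ) : ℤ_[2]) := by
    have h1 : (algebraMap ℤ_[2] ℚ_[2]) ((ϖ.den : ℤ) : ℤ_[2]) = (((ϖ.den : ℤ) : ℚ) : ℚ_[2]) := by
      simp
    have h2 : (algebraMap ℤ_[2] ℚ_[2]) ((ϖ.num : ℤ) : ℤ_[2]) = (((ϖ.num : ℤ) : ℚ) : ℚ_[2]) := by
      simp
    rw [h1, h2, ← hden]
    push_cast
    ring
  rw [map_mul, map_mul, PowerSeries.map_C, PowerSeries.map_C, h, ← mul_assoc, ← map_mul, key]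

/-! ## §2 The prediction, per curve: a generator of `char X⁺` vanishes at the order-2 character -/

section Prediction

variable (W : WeierstrassCurve ℚ) [W.IsElliptic] [W.IsGloballyMinimal]

/-- **THE PREDICTION OF THE HARDEST STUB AT THE ORDER-2 CHARACTER.** `E = W` with good reduction at
`2`, `a₂ = 0`, and `w_E · χ₈(N_E) = +1`; assume the Eisenstein half `KobayashiLowerDivisibility W 2 1`
(the registered `stub_zeroKobayashiLower` at this curve). Then for every cyclotomic datum `(κ, γ)`,
the newform `f`, every period ratio `ϖ`, every Pollack pair at `2` and every dual datum `D` of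
`Sel⁺(E/ℚ_∞)`: EVERY generator `g` of `char X⁺ = D.charIdeal` has `g(−2) = 0`
(`BlindLever.evalAt (−2) g = 0`). Proof: the stub gives `char X⁺ = (g₀)`, `ι g₀ = ϖ·ι(L♭·h)`; at `2`,
`a₂ = 0`, the Pollack pair is a Sprung pair with `a = 0` (`isSprungPair_zero_iff`), so the tree's
blind `♭`-law gives `L♭(−2) = 0` (`BlindFlat.flatLaw_evalAt_neg_two_of_rootNumber`); clearing the
denominator of `ϖ` (§1) and evaluating at `−2` (`evalAt_mul`, `‖−2‖₂ < 1`) gives `den(ϖ)·g₀(−2) = 0`,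
so `g₀(−2) = 0`; any other generator is an associate of `g₀` (`Λ` a domain). I.e. `(T + 2) ∣ char X⁺`.
[cite: Kobayashi2003, Conjecture (p. 2) and Def. 1.1] [cite: Sprung2017, Thm. 1.12 and Cor. 4.4]
[cite: MazurTateTeitelbaum1986Invent, §I.17] [cite: Pollack2003, Prop. 6.18] -/
theorem evalAt_neg_two_charGenerator_eq_zero_of_kobayashiLowerDivisibility_two
    (hgood : W.HasGoodReductionAtPrime 2) (ha : W.frobeniusTrace 2 = 0)
    (hsign : W.rootNumber * ZMod.χ₈ (W.conductorNorm ℤ : ZMod 8) = 1)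
    (hlow : KobayashiLowerDivisibility W 2 1)
    (κ : ZpExtension ℚ 2) (γ : Field.absoluteGaloisGroup ℚ)
    (hκ : κ.IsCyclotomic) (hγ : κ.IsTopGenerator γ) (hγ' : IsCyclotomicVariable 2 γ)
    [NeZero (W.conductorNorm ℤ)] (f : CuspForm (Gamma0 (W.conductorNorm ℤ)) 2) (hf : IsNewformOf W f)
    (ϖ : ℚ) (hϖ : (ϖ : ℝ) * W.realPeriodRat = plusPeriod f)
    (Lplus Lminus : IwasawaAlgebra 2) (hPP : IsPollackPair f 2 Lplus Lminus)
    (D : SignedSelmerDualData W κ γ 1) (g : IwasawaAlgebra 2) (hg : D.charIdeal = Ideal.span {g}) :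
    evalAt (-2 : ℤ_[2]) g = 0 := by
  have ht : ‖(-2 : ℤ_[2])‖ < 1 := norm_neg_two_lt_one
  obtain ⟨g₀, h, hchar, hι⟩ := hlow κ γ hκ hγ hγ' f hf ϖ hϖ Lplus Lminus hPP D
  have hkL : kobayashiL (1 : ℤˣ) Lplus Lminus = Lminus := by unfold kobayashiL; rw [if_pos rfl]
  rw [hkL] at hι
  -- the forced zero `L♭(−2) = 0` (Pollack pair = Sprung pair with `a = 0` at `2`)
  have hSP : IsSprungPair f 2 (W.frobeniusTrace 2) Lplus Lminus := by
    rw [ha]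
    exact (isSprungPair_zero_iff f 2 Lplus Lminus).mpr ⟨hPP.2.2.1, hPP.2.2.2⟩
  have hlaw := BlindFlat.flatLaw_evalAt_neg_two_of_rootNumber hf hgood
    (by rw [ha]; exact dvd_zero 2) hsign hSP
  rw [ha] at hlaw
  have hLm : evalAt (-2 : ℤ_[2]) Lminus = 0 := by
    have h9 : (9 - ((0 : ℤ) : ℤ_[2]) ^ 2) ≠ 0 := by norm_num
    simpa [h9] using hlaw
  -- clear the denominator of `ϖ` and evaluate at `−2`
  have hint := C_den_mul_eq_C_num_mul_of_iwasawaToPowerSeries_eq hι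
  have hev := congrArg (evalAt (-2 : ℤ_[2])) hint
  rw [evalAt_mul ht, evalAt_C, evalAt_mul ht, evalAt_C, evalAt_mul ht, hLm, zero_mul,
    mul_zero] at hev
  have hden : ((ϖ.den : ℤ) : ℤ_[2]) ≠ 0 := by
    exact_mod_cast (Rat.den_pos ϖ).ne'
  have hg₀ : evalAt (-2 : ℤ_[2]) g₀ = 0 := (mul_eq_zero.mp hev).resolve_left hden
  -- every generator is an associate of `g₀`
  have hassoc : Associated g₀ g := Ideal.span_singleton_eq_span_singleton.mp (hchar.symm.trans hg)
  obtain ⟨u, hu⟩ := hassoc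
  rw [← hu, evalAt_mul ht, hg₀, zero_mul]

/-- **On the crux's domain the sign is the conductor class mod 8.** In analytic rank `0` the root
number is `+1` UNCONDITIONALLY (`rootNumber_eq_one_of_even_analyticRank`), so the prediction reads:
`a₂ = 0`, `χ₈(N_E) = +1` (`N_E ≡ ±1 (mod 8)`), `KobayashiLowerDivisibility W 2 1` ⇒ every generator of
`char X⁺(E/ℚ_∞)` vanishes at `T = −2`. [cite: SilvermanAEC2009, C.16 Thm. 16.3]
[cite: Kobayashi2003, Conjecture (p. 2)] [cite: Sprung2017, Thm. 1.12 and Cor. 4.4] -/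
theorem evalAt_neg_two_charGenerator_eq_zero_of_kobayashiLowerDivisibility_two_of_rankZero
    (hgood : W.HasGoodReductionAtPrime 2) (ha : W.frobeniusTrace 2 = 0) (hr : W.analyticRank = 0)
    (hχ : ZMod.χ₈ (W.conductorNorm ℤ : ZMod 8) = 1)
    (hlow : KobayashiLowerDivisibility W 2 1)
    (κ : ZpExtension ℚ 2) (γ : Field.absoluteGaloisGroup ℚ)
    (hκ : κ.IsCyclotomic) (hγ : κ.IsTopGenerator γ) (hγ' : IsCyclotomicVariable 2 γ)
    [NeZero (W.conductorNorm ℤ)] (f : CuspForm (Gamma0 (W.conductorNorm ℤ)) 2) (hf : IsNewformOf W f)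
    (ϖ : ℚ) (hϖ : (ϖ : ℝ) * W.realPeriodRat = plusPeriod f)
    (Lplus Lminus : IwasawaAlgebra 2) (hPP : IsPollackPair f 2 Lplus Lminus)
    (D : SignedSelmerDualData W κ γ 1) (g : IwasawaAlgebra 2) (hg : D.charIdeal = Ideal.span {g}) :
    evalAt (-2 : ℤ_[2]) g = 0 := by
  have hw : W.rootNumber = 1 := W.rootNumber_eq_one_of_even_analyticRank (by rw [hr]; exact ⟨0, rfl⟩)
  exact evalAt_neg_two_charGenerator_eq_zero_of_kobayashiLowerDivisibility_two W hgood ha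
    (by rw [hw, one_mul, hχ]) hlow κ γ hκ hγ hγ' f hf ϖ hϖ Lplus Lminus hPP D g hg

end Prediction

/-! ## §3 Class level: the registered `stub_zeroKobayashiLower` ⇒ the order-2 zero on the whole sub-row -/

/-- **CLASS LEVEL: `stub_zeroKobayashiLower` (registered signature VERBATIM as the hypothesis) ⇒ on the
`a₂ = 0` sub-row of the crux's domain with `χ₈(N_E) = +1`, every characteristic power series of
`X⁺(E/ℚ_∞)` (every cyclotomic datum, newform, period ratio, Pollack pair, dual datum, generator)
vanishes at the order-2 character `T = −2`.** The falsifiable algebraic content of the hardest stub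
at the second `ℤ₂`-point of `Λ`. [cite: Kobayashi2003, Conjecture (p. 2) and Def. 1.1]
[cite: Sprung2017, Thm. 1.12 and Cor. 4.4] [cite: SilvermanAEC2009, C.16 Thm. 16.3] -/
theorem zeroKobayashiLower_prediction_orderTwoChar
    (hlow : ∀ (W : WeierstrassCurve ℚ) [W.IsElliptic] [W.IsGloballyMinimal],
      ¬ W.HasCM → W.analyticRank = 0 → GoodSS W 2 → W.frobeniusTrace 2 = 0 →
        KobayashiLowerDivisibility W 2 1) :
    ∀ (W : WeierstrassCurve ℚ) [W.IsElliptic] [W.IsGloballyMinimal],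
      ¬ W.HasCM → W.analyticRank = 0 → GoodSS W 2 → W.frobeniusTrace 2 = 0 →
      ZMod.χ₈ (W.conductorNorm ℤ : ZMod 8) = 1 →
      ∀ (κ : ZpExtension ℚ 2) (γ : Field.absoluteGaloisGroup ℚ),
        κ.IsCyclotomic → κ.IsTopGenerator γ → IsCyclotomicVariable 2 γ →
      ∀ [NeZero (W.conductorNorm ℤ)] (f : CuspForm (Gamma0 (W.conductorNorm ℤ)) 2),
        IsNewformOf W f → ∀ (ϖ : ℚ), (ϖ : ℝ) * W.realPeriodRat = plusPeriod f →
      ∀ (Lplus Lminus : IwasawaAlgebra 2), IsPollackPair f 2 Lplus Lminus →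
      ∀ (D : SignedSelmerDualData W κ γ 1) (g : IwasawaAlgebra 2), D.charIdeal = Ideal.span {g} →
        evalAt (-2 : ℤ_[2]) g = 0 :=
  fun W _ _ hcm hr hss ha hχ κ γ hκ hγ hγ' _ f hf ϖ hϖ Lp Lm hPP D g hg ↦
    evalAt_neg_two_charGenerator_eq_zero_of_kobayashiLowerDivisibility_two_of_rankZero W hss.1 ha hr hχ
      (hlow W hcm hr hss ha) κ γ hκ hγ hγ' f hf ϖ hϖ Lp Lm hPP D g hg

end Summit.BirchSwinnertonDyer.BirchSwinnertonDyer.Theorems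

end
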